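import Mathlib
import Summits.CriticalPhenomena.CardyFormulaZ2.Theorems.CardyMagicRigidityNestingRigidityTreeRigidityTameAssemblyRigid
import Summits.CriticalPhenomena.CardyFormulaZ2.Theorems.CardyMagicRigidityNestingRigidityTreeRigidityTameAssemblyGluing
import Summits.CriticalPhenomena.CardyFormulaZ2.Theorems.CardyMagicRigidityNestingRigidityTreeRigidityCoupling
import HarnessLib

/-!
# Stub `treeRigidityTame_of_tameRigidity`, steps (2)–(3) at law level: equal typed cylinder laws ⇒ `d_CN = 0`

Crux `Summit.CriticalPhenomena.CardyFormulaZ2.Theses.CardyMagicRigidity.NestingRigidity`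
(stmt-CriticalPhenomena-4835), line `positive-cone-weight-doubling`, registered helper
`treeRigidityTame_of_tameRigidity : (tame rigidity) → TreeRigidityTame` (vocabulary of
`Theorems/CardyMagicRigidityPositiveConeJointDefs.lean`, p130599).  This file closes its steps (2)–(3) at
LAW level: two presentations `X, X' : ([0,1], Leb) → C` with a.e. `Regular` values carrying `Tame` loops,
measurable typed pattern counts, and THE SAME JOINT CYLINDER PROBABILITIES of the typed two-disc pattern
counts at positive rational data (finitely many disc families at a time) are at DKKMO coupling distance
`d_CN((Leb, X), (Leb, X')) = 0` — under the tame rigidity hypothesis (registered neighbour `tame_rigidity`,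
taken as an explicit hypothesis, never asserted).  No new definitions: the countable statistic
`c ↦ ((x, r, R) ↦ (t, S) ↦ N^{(t)}_S(c; x, r, R))` (value `0` at `S = ∅`) is built inside the proof.

* §1 `measure_pi_ext_of_cylinders` — two probability measures on a product `ι → V` (`V` countable with
  measurable singletons) agreeing on all point cylinders over finite index TUPLES are equal (the tuple
  cylinders form a π-system generating the product σ-algebra; `ext_of_generate_finite`).
* §2 `cnLawEDist_eq_zero_of_map_eq_of_imp` — the law-level device of steps (2)–(3) in abstract form: if
  two measurable statistics `f ∘ X`-like maps `f, g : [0,1] → γ` (standard Borel `γ`) have the same law and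
  equality `f s = g s'` at good parameters forces `d_CN(X s, X' s') ≤ ε` for all `ε > 0`, then
  `d_CN((Leb, X), (Leb, X')) = 0` (coupling along equal laws, `exists_coupling_volume_eq_of_map_eq`,
  p129918; a.s.-close couplings witness distance `0`, `cnLawEDist_eq_zero_of_coupling`, p131483).
* §3 `cnLawEDist_eq_zero_of_typedCylinders_eq` (registered anchor) — equal joint typed cylinder
  probabilities at positive rational two-disc data suffice: §1 upgrades them to equality of the laws of the
  countable typed count statistic, §2 couples, and pathwise the configuration-level rigidity on tame
  supports `isClose_of_tame_of_typedCounts_eq` (p131405) applies (non-positive windows count nothing,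
  `patternCount_eq_zero_of_nonpos`).
-/

noncomputable section

open MeasureTheory Set Filter Metric
open scoped Real Topology BigOperators ENNReal

namespace Summit.CriticalPhenomena.CardyFormulaZ2.Cruxes.NestingRigidity.PositiveConeWeightDoubling

open Literature.Probability.RandomPlanarGeometry Literature.Probability.Percolation
  Literature.Probability.LatticeModels
open Summit.CriticalPhenomena.CardyFormulaZ2.Theses.CardyMagicRigidity
open Summit.CriticalPhenomena.CardyFormulaZ2.Cruxes.NestingRigidity.RingCloudTomography

/-! ## §1 Probability measures on products are determined by tuple point cylinders -/

/-- **Uniqueness from tuple point cylinders.**  Two probability measures on `ι → V`, `V` countable with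
measurable singletons, that agree on every point cylinder `{y | ∀ j, y (g j) = v j}` over a finite index
TUPLE `g : Fin J → ι` coincide: these cylinders form a π-system (concatenate the tuples, `Fin.append`)
generating the product σ-algebra (a coordinate event is a countable union of one-point cylinders). -/
theorem measure_pi_ext_of_cylinders {ι V : Type*} [MeasurableSpace V] [MeasurableSingletonClass V]
    [Countable V] (μ ν : Measure (ι → V)) [IsProbabilityMeasure μ] [IsProbabilityMeasure ν]
    (h : ∀ (J : ℕ) (g : Fin J → ι) (v : Fin J → V),
      μ {y | ∀ j, y (g j) = v j} = ν {y | ∀ j, y (g j) = v j}) : μ = ν := by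
  classical
  set C : Set (Set (ι → V)) :=
    {A | ∃ (J : ℕ) (g : Fin J → ι) (v : Fin J → V), A = {y | ∀ j, y (g j) = v j}} with hC
  have hmeasC : ∀ A ∈ C, MeasurableSet A := by
    rintro A ⟨J, g, v, rfl⟩
    have : {y : ι → V | ∀ j, y (g j) = v j} = ⋂ j, (fun y : ι → V ↦ y (g j)) ⁻¹' {v j} := by
      ext y
      simp
    rw [this]
    exact MeasurableSet.iInter fun j ↦ measurable_pi_apply (g j) (measurableSet_singleton (v j))
  have hpi : IsPiSystem C := by
    rintro A ⟨J, g, v, rfl⟩ B ⟨J', g', v', rfl⟩ -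
    refine ⟨J + J', Fin.append g g', Fin.append v v', ?_⟩
    ext y
    simp only [mem_inter_iff, mem_setOf_eq]
    rw [Fin.forall_fin_add (fun j ↦ y (Fin.append g g' j) = Fin.append v v' j)]
    simp only [Fin.append_left, Fin.append_right]
  have hgen : (MeasurableSpace.pi : MeasurableSpace (ι → V)) = MeasurableSpace.generateFrom C := by
    refine le_antisymm ?_ (MeasurableSpace.generateFrom_le hmeasC)
    refine iSup_le fun i ↦ ?_
    intro s hs
    obtain ⟨B, -, rfl⟩ := MeasurableSpace.measurableSet_comap.1 hs
    have : (fun y : ι → V ↦ y i) ⁻¹' B =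
        ⋃ b ∈ B, {y : ι → V | ∀ j : Fin 1, y ((fun _ ↦ i) j) = (fun _ ↦ b) j} := by
      ext y
      simp
    rw [this]
    exact MeasurableSet.biUnion (Set.to_countable B) fun b _ ↦
      MeasurableSpace.measurableSet_generateFrom ⟨1, fun _ ↦ i, fun _ ↦ b, rfl⟩
  refine ext_of_generate_finite C hgen hpi (fun A hA ↦ ?_) (by rw [measure_univ, measure_univ])
  obtain ⟨J, g, v, rfl⟩ := hA
  exact h J g v

/-! ## §2 Coupling along equal laws of a statistic that forces closeness -/

/-- An a.e. property under the first marginal lifts to the coupling. -/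
theorem ae_fst_of_map_fst_eq {α β : Type*} [MeasurableSpace α] [MeasurableSpace β] {μ : Measure α}
    {P : Measure (α × β)} (h₁ : P.map Prod.fst = μ) {p : α → Prop} (h : ∀ᵐ a ∂μ, p a) :
    ∀ᵐ q ∂P, p q.1 := by
  rw [← h₁] at h
  exact ae_of_ae_map measurable_fst.aemeasurable h

/-- An a.e. property under the second marginal lifts to the coupling. -/
theorem ae_snd_of_map_snd_eq {α β : Type*} [MeasurableSpace α] [MeasurableSpace β] {ν : Measure β}
    {P : Measure (α × β)} (h₂ : P.map Prod.snd = ν) {p : β → Prop} (h : ∀ᵐ b ∂ν, p b) :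
    ∀ᵐ q ∂P, p q.2 := by
  rw [← h₂] at h
  exact ae_of_ae_map measurable_snd.aemeasurable h

/-- **Equal laws of a closeness-forcing statistic give `d_CN = 0`.**  Let `X, X'` be presentations on
`([0,1], Leb)`, `G, G'` a.e.-sure properties of the parameter, and `f, g : [0,1] → γ` measurable
statistics into a standard Borel space with THE SAME LAW, such that at good parameters `f s = g s'` forces
`d_CN(X s, X' s') ≤ ε` for every `ε > 0`.  Then `d_CN((Leb, X), (Leb, X')) = 0`: couple the two copies of
`[0,1]` along the statistic (`exists_coupling_volume_eq_of_map_eq`, p129918) and use that an a.s.-close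
coupling witnesses distance `0` (`cnLawEDist_eq_zero_of_coupling`, p131483). -/
theorem cnLawEDist_eq_zero_of_map_eq_of_imp {γ : Type} [MeasurableSpace γ] [StandardBorelSpace γ]
    {X X' : unitInterval → LoopConfig ℂ} {G G' : unitInterval → Prop}
    (hG : ∀ᵐ s : unitInterval, G s) (hG' : ∀ᵐ s : unitInterval, G' s) (f g : unitInterval → γ)
    (hf : Measurable f) (hg : Measurable g)
    (hlaw : (volume : Measure unitInterval).map f = (volume : Measure unitInterval).map g)
    (himp : ∀ s s', G s → G' s' → f s = g s' → ∀ ε : ℝ, 0 < ε → LoopConfig.IsClose ε (X s) (X' s')) :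
    LoopConfig.cnLawEDist volume X volume X' = 0 := by
  obtain ⟨P, h₁, h₂, hP⟩ := exists_coupling_volume_eq_of_map_eq f g hf hg hlaw
  refine cnLawEDist_eq_zero_of_coupling P h₁ h₂ ?_
  filter_upwards [hP, ae_fst_of_map_fst_eq h₁ hG, ae_snd_of_map_snd_eq h₂ hG'] with q hq h1 h2
  exact himp q.1 q.2 h1 h2 hq

/-! ## §3 Equal joint typed cylinder probabilities at positive rational data suffice (registered anchor) -/

/-- A non-positive window counts nothing (the window `B(0, R)` is empty, traces are not). -/
theorem patternCount_eq_zero_of_nonpos (c : LoopConfig ℂ) {n : ℕ} (x : Fin n → ℂ) (r : Fin n → ℝ)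
    {R : ℝ} (hR : R ≤ 0) (S : Finset (Fin n)) : patternCount c x r R S = 0 := by
  unfold patternCount
  convert Set.ncard_empty (UnbasedLoop ℂ)
  refine Set.eq_empty_of_forall_notMem fun u hu ↦ ?_
  obtain ⟨y, hy⟩ := u.range_nonempty
  have := hu.2.1 hy
  rw [Metric.ball_eq_empty.2 hR] at this
  exact this

/-- **Equal joint typed cylinder probabilities give `d_CN = 0` (steps (2)–(3) of
`treeRigidityTame_of_tameRigidity`; registered anchor).**  Assume tame rigidity.  Let `X, X'` be two
presentations on `([0,1], Leb)` with a.e. `Regular` values all of whose loops are `Tame`, with measurable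
typed pattern counts, and suppose that for every finite family of positive rational two-disc data
(rational centres `x j`, positive rational radii `r j`, positive rational windows `R j`, `j < J`) and
every table of values `k`, the JOINT cylinder probabilities of the typed pattern counts agree:
`Leb{s | ∀ j t S ≠ ∅, N^{(t)}_S(X s; x j, r j, R j) = k j t S} = Leb{s | … X' …}`.  Then
`d_CN((Leb, X), (Leb, X')) = 0`.  Proof: the countable statistic of all typed counts at positive rational
data (value `0` at `S = ∅`) has the same LAW under both presentations (§1: its tuple point cylinders are the
joint cylinder events, or empty), so §2 applies with the pathwise rigidity
`isClose_of_tame_of_typedCounts_eq` (p131405). -/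
theorem cnLawEDist_eq_zero_of_typedCylinders_eq :
    (∀ u v : UnbasedLoop ℂ, Tame u → Tame v → (∀ z, u.wind z = v.wind z) → u = v) →
    ∀ (X X' : unitInterval → LoopConfig ℂ),
    (∀ᵐ s : unitInterval, Regular (X s) ∧ ∀ u ∈ (X s).loops, Tame u) →
    (∀ᵐ s : unitInterval, Regular (X' s) ∧ ∀ u ∈ (X' s).loops, Tame u) →
    (∀ (i : Fin 2) (n : ℕ) (x : Fin n → ℂ) (r : Fin n → ℝ) (R : ℝ) (S : Finset (Fin n)),
      Measurable (fun s ↦ typedPatternCount (X s) i x r R S) ∧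
      Measurable (fun s ↦ typedPatternCount (X' s) i x r R S)) →
    (∀ (J : ℕ) (x : Fin J → Fin 2 → ℚ × ℚ) (r : Fin J → Fin 2 → ℚ) (R : Fin J → ℚ)
      (k : Fin J → Fin 2 → Finset (Fin 2) → ℕ), (∀ j i, 0 < r j i) → (∀ j, 0 < R j) →
      volume {s : unitInterval | ∀ j t, ∀ S : Finset (Fin 2), S.Nonempty →
        typedPatternCount (X s) t (fun i ↦ (⟨(x j i).1, (x j i).2⟩ : ℂ)) (fun i ↦ (r j i : ℝ)) (R j) S =
          k j t S} =
      volume {s : unitInterval | ∀ j t, ∀ S : Finset (Fin 2), S.Nonempty →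
        typedPatternCount (X' s) t (fun i ↦ (⟨(x j i).1, (x j i).2⟩ : ℂ)) (fun i ↦ (r j i : ℝ)) (R j) S =
          k j t S}) →
    LoopConfig.cnLawEDist volume X volume X' = 0 := by
  intro hrig X X' hX hX' hmeas hcyl
  classical
  -- the countable typed count statistic at positive rational data (`0` at the empty pattern)
  set Φ : LoopConfig ℂ → ((Fin 2 → ℚ × ℚ) × (Fin 2 → {s : ℚ // 0 < s}) × {R : ℚ // 0 < R}) →
      Fin 2 → Finset (Fin 2) → ℕ := fun c f t S ↦ if S.Nonempty then
        typedPatternCount c t (fun j ↦ (⟨(f.1 j).1, (f.1 j).2⟩ : ℂ)) (fun j ↦ ((f.2.1 j : ℚ) : ℝ))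
          ((f.2.2 : ℚ) : ℝ) S else 0 with hΦ
  have hΦS : ∀ c f t S, S.Nonempty → Φ c f t S =
      typedPatternCount c t (fun j ↦ (⟨(f.1 j).1, (f.1 j).2⟩ : ℂ)) (fun j ↦ ((f.2.1 j : ℚ) : ℝ))
        ((f.2.2 : ℚ) : ℝ) S := fun c f t S hS ↦ by simp only [hΦ, hS, if_true]
  have hΦ0 : ∀ c f t S, ¬ S.Nonempty → Φ c f t S = 0 := fun c f t S hS ↦ by simp only [hΦ, hS, if_false]
  clear_value Φ
  -- measurability of the statistic
  have hmΦ : ∀ Y : unitInterval → LoopConfig ℂ,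
      (∀ (i : Fin 2) (n : ℕ) (x : Fin n → ℂ) (r : Fin n → ℝ) (R : ℝ) (S : Finset (Fin n)),
        Measurable fun s ↦ typedPatternCount (Y s) i x r R S) → Measurable fun s ↦ Φ (Y s) := by
    intro Y hY
    refine measurable_pi_iff.2 fun f ↦ measurable_pi_iff.2 fun t ↦ measurable_pi_iff.2 fun S ↦ ?_
    by_cases hS : S.Nonempty
    · simp only [hΦS _ _ _ _ hS]
      exact hY t 2 _ _ _ S
    · simp only [hΦ0 _ _ _ _ hS]
      exact measurable_const
  have hm : Measurable fun s ↦ Φ (X s) := hmΦ X fun i n x r R S ↦ (hmeas i n x r R S).1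
  have hm' : Measurable fun s ↦ Φ (X' s) := hmΦ X' fun i n x r R S ↦ (hmeas i n x r R S).2
  -- equal statistics give the hypothesis of the configuration-level rigidity theorem
  have hcounts : ∀ c c' : LoopConfig ℂ, Φ c = Φ c' →
      ∀ (i : Fin 2) (x : Fin 2 → ℚ × ℚ) (r : Fin 2 → ℚ) (R : ℚ) (S : Finset (Fin 2)),
        (∀ j, 0 < r j) → S.Nonempty →
        typedPatternCount c i (fun j ↦ (⟨(x j).1, (x j).2⟩ : ℂ)) (fun j ↦ (r j : ℝ)) R S =
          typedPatternCount c' i (fun j ↦ (⟨(x j).1, (x j).2⟩ : ℂ)) (fun j ↦ (r j : ℝ)) R S := by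
    intro c c' h i x r R S hr hS
    by_cases hR : 0 < R
    · have key := congrFun (congrFun (congrFun h (x, fun j ↦ ⟨r j, hr j⟩, ⟨R, hR⟩)) i) S
      rwa [hΦS _ _ _ _ hS, hΦS _ _ _ _ hS] at key
    · have hR' : (R : ℝ) ≤ 0 := by exact_mod_cast not_lt.1 hR
      simp only [typedPatternCount, patternCount_eq_zero_of_nonpos _ _ _ hR']
  -- the two laws of the statistic agree: their tuple point cylinders are joint cylinder events (or empty)
  have hcylΦ : ∀ (Y : unitInterval → LoopConfig ℂ) {J : ℕ}
      (g : Fin J → (Fin 2 → ℚ × ℚ) × (Fin 2 → {s : ℚ // 0 < s}) × {R : ℚ // 0 < R})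
      (v : Fin J → Fin 2 → Finset (Fin 2) → ℕ), (∀ j t S, ¬ S.Nonempty → v j t S = 0) →
      {s | ∀ j, Φ (Y s) (g j) = v j} = {s | ∀ j t, ∀ S : Finset (Fin 2), S.Nonempty →
        typedPatternCount (Y s) t (fun i ↦ (⟨((g j).1 i).1, ((g j).1 i).2⟩ : ℂ))
          (fun i ↦ (((g j).2.1 i : ℚ) : ℝ)) (((g j).2.2 : ℚ) : ℝ) S = v j t S} := by
    intro Y J g v hv
    ext s
    simp only [mem_setOf_eq, funext_iff]
    refine forall_congr' fun j ↦ forall_congr' fun t ↦ forall_congr' fun S ↦ ?_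
    by_cases hS : S.Nonempty
    · simp only [hΦS _ _ _ _ hS, hS, forall_const]
    · simp only [hΦ0 _ _ _ _ hS, hS, IsEmpty.forall_iff, iff_true]
      exact (hv j t S hS).symm
  have hcylΦ' : ∀ (Y : unitInterval → LoopConfig ℂ) {J : ℕ}
      (g : Fin J → (Fin 2 → ℚ × ℚ) × (Fin 2 → {s : ℚ // 0 < s}) × {R : ℚ // 0 < R})
      (v : Fin J → Fin 2 → Finset (Fin 2) → ℕ), (¬ ∀ j t S, ¬ S.Nonempty → v j t S = 0) →
      {s | ∀ j, Φ (Y s) (g j) = v j} = ∅ := by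
    intro Y J g v hv
    refine Set.eq_empty_of_forall_notMem fun s hs ↦ hv fun j t S hS ↦ ?_
    exact (congrFun (congrFun (hs j) t) S).symm.trans (hΦ0 _ _ _ _ hS)
  have hlaw : (volume : Measure unitInterval).map (fun s ↦ Φ (X s)) =
      (volume : Measure unitInterval).map (fun s ↦ Φ (X' s)) := by
    haveI : IsProbabilityMeasure ((volume : Measure unitInterval).map fun s ↦ Φ (X s)) :=
      Measure.isProbabilityMeasure_map hm.aemeasurable
    haveI : IsProbabilityMeasure ((volume : Measure unitInterval).map fun s ↦ Φ (X' s)) :=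
      Measure.isProbabilityMeasure_map hm'.aemeasurable
    refine measure_pi_ext_of_cylinders _ _ fun J g v ↦ ?_
    have hA : MeasurableSet {y : ((Fin 2 → ℚ × ℚ) × (Fin 2 → {s : ℚ // 0 < s}) × {R : ℚ // 0 < R}) →
        Fin 2 → Finset (Fin 2) → ℕ | ∀ j, y (g j) = v j} := by
      have : {y : ((Fin 2 → ℚ × ℚ) × (Fin 2 → {s : ℚ // 0 < s}) × {R : ℚ // 0 < R}) →
          Fin 2 → Finset (Fin 2) → ℕ | ∀ j, y (g j) = v j} = ⋂ j, (fun y ↦ y (g j)) ⁻¹' {v j} := by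
        ext y
        simp
      rw [this]
      exact MeasurableSet.iInter fun j ↦ measurable_pi_apply (g j) (measurableSet_singleton (v j))
    rw [Measure.map_apply hm hA, Measure.map_apply hm' hA]
    change volume {s | ∀ j, Φ (X s) (g j) = v j} = volume {s | ∀ j, Φ (X' s) (g j) = v j}
    by_cases hv : ∀ j t S, ¬ S.Nonempty → v j t S = 0
    · rw [hcylΦ X g v hv, hcylΦ X' g v hv]
      exact hcyl J (fun j ↦ (g j).1) (fun j i ↦ ((g j).2.1 i : ℚ)) (fun j ↦ ((g j).2.2 : ℚ)) v
        (fun j i ↦ ((g j).2.1 i).2) (fun j ↦ (g j).2.2.2)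
    · rw [hcylΦ' X g v hv, hcylΦ' X' g v hv]
  -- couple along the statistic and reconstruct pathwise
  exact cnLawEDist_eq_zero_of_map_eq_of_imp hX hX' _ _ hm hm' hlaw fun s s' h1 h2 heq ε hε ↦
    isClose_of_tame_of_typedCounts_eq hrig h1.1 h2.1 h1.2 h2.2 (hcounts _ _ heq) ε hε.le

/-- The symmetric conclusion `d_CN((Leb, X'), (Leb, X)) = 0` under the same hypotheses. -/
theorem cnLawEDist_eq_zero_of_typedCylinders_eq'
    (hrig : ∀ u v : UnbasedLoop ℂ, Tame u → Tame v → (∀ z, u.wind z = v.wind z) → u = v)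
    (X X' : unitInterval → LoopConfig ℂ)
    (hX : ∀ᵐ s : unitInterval, Regular (X s) ∧ ∀ u ∈ (X s).loops, Tame u)
    (hX' : ∀ᵐ s : unitInterval, Regular (X' s) ∧ ∀ u ∈ (X' s).loops, Tame u)
    (hmeas : ∀ (i : Fin 2) (n : ℕ) (x : Fin n → ℂ) (r : Fin n → ℝ) (R : ℝ) (S : Finset (Fin n)),
      Measurable (fun s ↦ typedPatternCount (X s) i x r R S) ∧
      Measurable (fun s ↦ typedPatternCount (X' s) i x r R S))
    (hcyl : ∀ (J : ℕ) (x : Fin J → Fin 2 → ℚ × ℚ) (r : Fin J → Fin 2 → ℚ) (R : Fin J → ℚ)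
      (k : Fin J → Fin 2 → Finset (Fin 2) → ℕ), (∀ j i, 0 < r j i) → (∀ j, 0 < R j) →
      volume {s : unitInterval | ∀ j t, ∀ S : Finset (Fin 2), S.Nonempty →
        typedPatternCount (X s) t (fun i ↦ (⟨(x j i).1, (x j i).2⟩ : ℂ)) (fun i ↦ (r j i : ℝ)) (R j) S =
          k j t S} =
      volume {s : unitInterval | ∀ j t, ∀ S : Finset (Fin 2), S.Nonempty →
        typedPatternCount (X' s) t (fun i ↦ (⟨(x j i).1, (x j i).2⟩ : ℂ)) (fun i ↦ (r j i : ℝ)) (R j) S =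
          k j t S}) :
    LoopConfig.cnLawEDist volume X' volume X = 0 := by
  rw [LoopConfig.cnLawEDist_comm]
  exact cnLawEDist_eq_zero_of_typedCylinders_eq hrig X X' hX hX' hmeas hcyl

end Summit.CriticalPhenomena.CardyFormulaZ2.Cruxes.NestingRigidity.PositiveConeWeightDoubling

end
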